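import Mathlib

/-!
# `MatrixDescartes` — line «finite» / «stamp»: SCALAR ESTIMATES for the arrow design on `(0,1,3)`
# (the inequalities behind the sign certificate of `…FiniteSectorLadderThree`)

HONEST FRAMING.  Object-search cell `pub-symmetroid`, seat val-sym-eng-3 g11 (census/instrument ENGINE #3 of D-0148 (b)).
HELPER of the crux item `stmt-ValiantsHypothesis-18050`
(`Summit.ValiantsHypothesis.ValiantsHypothesis.Theses.LacunarySymmetroid.MatrixDescartes`, asymptotic in `K`) with NO closure
claim; no census constant is named here (elementary real inequalities only); the design is described in `…FiniteSectorArrowDesign`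
and the realisability statement is assembled in `…FiniteSectorLadderThree`.  Nothing here bears on the crux or on `VP ≠ VNP`.

THE QUANTITIES (base `B`, later `B = 4(M+2) ≥ 8`; leaf index `j`, `0`-based): the leaf term
`G_j(t) = (1/B^{j+1} − t/B^{9j+8})² / (1 + t³/B^{24(j+1)})` of the Schur complement `h(t) = c(t) − ∑_j (-1)^{j+1} G_j(t)` and the
corner `c(t) = (-1)^M/B^{2M+2} − (-1)^M t/B^{10M+9}`.  Along `u = log_B t`:
* `G_j(t) ≤ B^{-2(j+1)}` for `0 ≤ t ≤ B^{8j+7}` (plateau, `arrowLeaf_plateau`) and `G_j(t) ≤ B^{6j+8}/t` for `t ≥ B^{8j+7}` (decay,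
  `arrowLeaf_decay`); uniform forms `arrowLeaf_above_le` / `arrowLeaf_below_le` (`≤ 1/B^e` from exponent bookkeeping);
* reference values `G_k(B^{8k+6}) ≥ ½ B^{-2(k+1)}` (`arrowLeaf_ref_pre`), `G_k(B^{8k+8}) ≥ ½ B^{-2(k+1)}` (`arrowLeaf_ref_peak`),
  `G_k(B^{8k+7}) = 0` (`arrowLeaf_dip_zero`), `G_{k+1}(B^{8k+7}) ≥ ½ B^{-2(k+2)}` (`arrowLeaf_ref_dip`);
* the corner: `|c(t)| ≤ B^{-2M-2}` for `0 ≤ t ≤ B^{8M+7}` (`arrowCorner_abs_le`); `(-1)^M c(B^{8k+7}) ≥ ½ B^{-2M-2}` for `k + 1 = M`,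
  `(-1)^M c(B^{8M+6}) ≥ ½ B^{-2M-2}`, `(-1)^{M+1} c(B^{8M+8}) ≥ ½ B^{-2M-2}` (`arrowCorner_ref`);
* `pos_of_dominant_term`: «reference `≥ R/2`, corner-type term and every other leaf `≤ R/B` in modulus, at most `M` leaves,
  `2(M+1) < B` ⇒ the signed sum is positive».
[folklore] Elementary real inequalities; no citation is load-bearing.
-/

-- `Summit.ValiantsHypothesis.ValiantsHypothesis.…` repeats a component by the D-0017 layout
-- (single-conjunct summit), which the `dupNamespace` linter flags; the name is mandated.
set_option linter.dupNamespace false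

namespace Summit.ValiantsHypothesis.ValiantsHypothesis.Theorems.LacunarySymmetroidMatrixDescartes.FiniteSector

open scoped BigOperators Matrix
open Polynomial Finset Matrix

/-! ## §2 Scalar estimates for the arrow design (base `B > 2(M+1)`, `B ≥ 8`) -/

/-- **Dominance bookkeeping.**  If `r ≥ R/2`, `|c| ≤ R/B`, `|y_j| ≤ R/B` on a finset of size `≤ M`, and `2(M+1) < B`,
then `r + c + ∑ y_j > 0`. [folklore] -/
theorem pos_of_dominant_term {ι : Type*} (s : Finset ι) (y : ι → ℝ) {r c R B : ℝ} {M : ℕ}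
    (hR : 0 < R) (hB : 0 < B) (hMB : 2 * ((M : ℝ) + 1) < B) (hr : R / 2 ≤ r) (hc : |c| ≤ R / B)
    (hy : ∀ j ∈ s, |y j| ≤ R / B) (hcard : s.card ≤ M) : 0 < r + c + ∑ j ∈ s, y j := by
  have h1 : |∑ j ∈ s, y j| ≤ s.card • (R / B) :=
    (Finset.abs_sum_le_sum_abs _ _).trans (Finset.sum_le_card_nsmul _ _ _ hy)
  rw [nsmul_eq_mul] at h1
  have h2 : (s.card : ℝ) * (R / B) ≤ (M : ℝ) * (R / B) :=
    mul_le_mul_of_nonneg_right (by exact_mod_cast hcard) (by positivity)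
  have h3 : ((M : ℝ) + 1) * (R / B) < R / 2 := by
    rw [show ((M : ℝ) + 1) * (R / B) = R * ((M + 1) / B) by ring, show R / 2 = R * (1 / 2) by ring]
    refine mul_lt_mul_of_pos_left ?_ hR
    rw [div_lt_iff₀ hB]
    linarith
  have hc' := (abs_le.1 hc).1
  have hs' := (abs_le.1 (h1.trans h2)).1
  nlinarith

/-- The leaf term `G_j(t) = b_j(t)² / (1 + t³/B^{24(j+1)})`, `b_j(t) = 1/B^{j+1} - t/B^{9j+8}`, on its PLATEAU:
for `0 ≤ t ≤ B^{8j+7}`, `G_j(t) ≤ 1/B^{2(j+1)}`. [folklore] -/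
theorem arrowLeaf_plateau {B t : ℝ} (hB : 1 ≤ B) (j : ℕ) (ht0 : 0 ≤ t) (ht : t ≤ B ^ (8 * j + 7)) :
    (1 / B ^ (j + 1) - t / B ^ (9 * j + 8)) ^ 2 / (1 + t ^ 3 / B ^ (24 * (j + 1))) ≤ 1 / B ^ (2 * (j + 1)) := by
  have hB0 : 0 < B := by linarith
  have hden : 1 ≤ 1 + t ^ 3 / B ^ (24 * (j + 1)) := le_add_of_nonneg_right (by positivity)
  have hb0 : 0 ≤ 1 / B ^ (j + 1) - t / B ^ (9 * j + 8) := by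
    rw [sub_nonneg, div_le_div_iff₀ (by positivity) (by positivity), one_mul]
    calc t * B ^ (j + 1) ≤ B ^ (8 * j + 7) * B ^ (j + 1) := mul_le_mul_of_nonneg_right ht (by positivity)
      _ = B ^ (9 * j + 8) := by rw [← pow_add]; ring_nf
  have hb1 : 1 / B ^ (j + 1) - t / B ^ (9 * j + 8) ≤ 1 / B ^ (j + 1) := sub_le_self _ (by positivity)
  calc (1 / B ^ (j + 1) - t / B ^ (9 * j + 8)) ^ 2 / (1 + t ^ 3 / B ^ (24 * (j + 1)))
      ≤ (1 / B ^ (j + 1) - t / B ^ (9 * j + 8)) ^ 2 := div_le_self (by positivity) hden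
    _ ≤ (1 / B ^ (j + 1)) ^ 2 := pow_le_pow_left₀ hb0 hb1 2
    _ = 1 / B ^ (2 * (j + 1)) := by rw [div_pow, one_pow, ← pow_mul, mul_comm]

/-- The leaf term past its window DECAYS like `1/t`: for `t ≥ B^{8j+7}` (`B ≥ 1`), `G_j(t) ≤ B^{6j+8}/t`. [folklore] -/
theorem arrowLeaf_decay {B t : ℝ} (hB : 1 ≤ B) (j : ℕ) (ht : B ^ (8 * j + 7) ≤ t) :
    (1 / B ^ (j + 1) - t / B ^ (9 * j + 8)) ^ 2 / (1 + t ^ 3 / B ^ (24 * (j + 1))) ≤ B ^ (6 * j + 8) / t := by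
  have hB0 : 0 < B := by linarith
  have ht0 : 0 < t := lt_of_lt_of_le (by positivity) ht
  -- `b_j(t) = (1 - x)/B^{j+1}` with `x = t/B^{8j+7} ≥ 1`, so `b_j² ≤ x²/B^{2j+2} = t²/B^{18j+16}`
  have hsq : (1 / B ^ (j + 1) - t / B ^ (9 * j + 8)) ^ 2 ≤ t ^ 2 / B ^ (18 * j + 16) := by
    have hx : (1 / B ^ (j + 1) - t / B ^ (9 * j + 8)) = (B ^ (8 * j + 7) - t) / B ^ (9 * j + 8) := by
      field_simp
      ring
    rw [hx, div_pow, div_le_div_iff₀ (by positivity) (by positivity)]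
    have h1 : (B ^ (8 * j + 7) - t) ^ 2 ≤ t ^ 2 := by nlinarith [pow_pos hB0 (8 * j + 7)]
    calc (B ^ (8 * j + 7) - t) ^ 2 * B ^ (18 * j + 16) ≤ t ^ 2 * B ^ (18 * j + 16) :=
          mul_le_mul_of_nonneg_right h1 (by positivity)
      _ = t ^ 2 * (B ^ (9 * j + 8)) ^ 2 := by rw [← pow_mul]; ring_nf
  have hden : t ^ 3 / B ^ (24 * (j + 1)) ≤ 1 + t ^ 3 / B ^ (24 * (j + 1)) := le_add_of_nonneg_left zero_le_one
  calc (1 / B ^ (j + 1) - t / B ^ (9 * j + 8)) ^ 2 / (1 + t ^ 3 / B ^ (24 * (j + 1)))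
      ≤ (t ^ 2 / B ^ (18 * j + 16)) / (t ^ 3 / B ^ (24 * (j + 1))) := by
        refine div_le_div₀ (by positivity) hsq (by positivity) hden
    _ = B ^ (6 * j + 8) / t := by
        rw [div_div_div_eq, div_eq_div_iff (by positivity) (by positivity)]
        rw [show 24 * (j + 1) = (18 * j + 16) + (6 * j + 8) by ring, pow_add]
        ring

/-- Pre-dip reference value: at `t = B^{8k+6}` (`B ≥ 8`) the leaf term is `≥ ½ / B^{2(k+1)}`. [folklore] -/
theorem arrowLeaf_ref_pre {B : ℝ} (hB : 8 ≤ B) (k : ℕ) :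
    1 / B ^ (2 * (k + 1)) / 2 ≤
      (1 / B ^ (k + 1) - B ^ (8 * k + 6) / B ^ (9 * k + 8)) ^ 2 / (1 + (B ^ (8 * k + 6)) ^ 3 / B ^ (24 * (k + 1))) := by
  have hB0 : 0 < B := by linarith
  have hb : 1 / B ^ (k + 1) - B ^ (8 * k + 6) / B ^ (9 * k + 8) = (1 - 1 / B) / B ^ (k + 1) := by
    field_simp
    ring
  have hd : (B ^ (8 * k + 6)) ^ 3 / B ^ (24 * (k + 1)) = 1 / B ^ 6 := by
    rw [div_eq_div_iff (by positivity) (by positivity), one_mul, ← pow_mul, ← pow_add]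
    ring_nf
  rw [hb, hd, div_pow, show (B ^ (k + 1)) ^ 2 = B ^ (2 * (k + 1)) by rw [← pow_mul]; ring_nf]
  have h34 : 3 / 4 ≤ (1 - 1 / B) ^ 2 := by
    have : 1 / B ≤ 1 / 8 := by rw [div_le_div_iff₀ hB0 (by norm_num)]; linarith
    nlinarith
  have h6 : 1 / B ^ 6 ≤ 1 / 2 := by
    rw [div_le_div_iff₀ (by positivity) (by norm_num)]
    nlinarith [pow_le_pow_left₀ (by norm_num : (0:ℝ) ≤ 8) hB 6]
  have hAD : 1 / 2 ≤ (1 - 1 / B) ^ 2 / (1 + 1 / B ^ 6) := by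
    rw [le_div_iff₀ (by positivity)]
    nlinarith
  calc 1 / B ^ (2 * (k + 1)) / 2 = (1 / 2) * (1 / B ^ (2 * (k + 1))) := by ring
    _ ≤ ((1 - 1 / B) ^ 2 / (1 + 1 / B ^ 6)) * (1 / B ^ (2 * (k + 1))) :=
        mul_le_mul_of_nonneg_right hAD (by positivity)
    _ = (1 - 1 / B) ^ 2 / B ^ (2 * (k + 1)) / (1 + 1 / B ^ 6) := by ring

/-- Peak reference value: at `t = B^{8k+8}` (`B ≥ 2`) the leaf term is `≥ ½ / B^{2(k+1)}`. [folklore] -/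
theorem arrowLeaf_ref_peak {B : ℝ} (hB : 2 ≤ B) (k : ℕ) :
    1 / B ^ (2 * (k + 1)) / 2 ≤
      (1 / B ^ (k + 1) - B ^ (8 * k + 8) / B ^ (9 * k + 8)) ^ 2 / (1 + (B ^ (8 * k + 8)) ^ 3 / B ^ (24 * (k + 1))) := by
  have hB0 : 0 < B := by linarith
  have hb : 1 / B ^ (k + 1) - B ^ (8 * k + 8) / B ^ (9 * k + 8) = (1 - B) / B ^ (k + 1) := by
    field_simp
    ring
  have hd : (B ^ (8 * k + 8)) ^ 3 / B ^ (24 * (k + 1)) = 1 := by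
    rw [div_eq_one_iff_eq (by positivity), ← pow_mul]
    ring_nf
  rw [hb, hd, div_pow, show (B ^ (k + 1)) ^ 2 = B ^ (2 * (k + 1)) by rw [← pow_mul]; ring_nf]
  have h1 : 1 ≤ (1 - B) ^ 2 := by nlinarith
  have hAD : 1 / 2 ≤ (1 - B) ^ 2 / (1 + 1) := by
    rw [le_div_iff₀ (by norm_num)]
    linarith
  calc 1 / B ^ (2 * (k + 1)) / 2 = (1 / 2) * (1 / B ^ (2 * (k + 1))) := by ring
    _ ≤ ((1 - B) ^ 2 / (1 + 1)) * (1 / B ^ (2 * (k + 1))) := mul_le_mul_of_nonneg_right hAD (by positivity)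
    _ = (1 - B) ^ 2 / B ^ (2 * (k + 1)) / (1 + 1) := by ring

/-- Dip: at `t = B^{8k+7}` the `k`-th border entry vanishes, so the `k`-th leaf term is `0`. [folklore] -/
theorem arrowLeaf_dip_zero {B : ℝ} (hB : 0 < B) (k : ℕ) :
    (1 / B ^ (k + 1) - B ^ (8 * k + 7) / B ^ (9 * k + 8)) ^ 2 / (1 + (B ^ (8 * k + 7)) ^ 3 / B ^ (24 * (k + 1))) = 0 := by
  have : 1 / B ^ (k + 1) - B ^ (8 * k + 7) / B ^ (9 * k + 8) = 0 := by
    rw [sub_eq_zero, div_eq_div_iff (by positivity) (by positivity), one_mul, ← pow_add]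
    ring_nf
  rw [this]
  simp

/-- Dip reference value: at `t = B^{8k+7}` (`B ≥ 8`) the NEXT leaf term (`j = k+1`) is `≥ ½ / B^{2(k+2)}`. [folklore] -/
theorem arrowLeaf_ref_dip {B : ℝ} (hB : 8 ≤ B) (k : ℕ) :
    1 / B ^ (2 * (k + 2)) / 2 ≤
      (1 / B ^ (k + 1 + 1) - B ^ (8 * k + 7) / B ^ (9 * (k + 1) + 8)) ^ 2
        / (1 + (B ^ (8 * k + 7)) ^ 3 / B ^ (24 * (k + 1 + 1))) := by
  have hB0 : 0 < B := by linarith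
  have hb : 1 / B ^ (k + 1 + 1) - B ^ (8 * k + 7) / B ^ (9 * (k + 1) + 8) = (1 - 1 / B ^ 8) / B ^ (k + 2) := by
    field_simp
    ring
  have hd : (B ^ (8 * k + 7)) ^ 3 / B ^ (24 * (k + 1 + 1)) = 1 / B ^ 27 := by
    rw [div_eq_div_iff (by positivity) (by positivity), one_mul, ← pow_mul, ← pow_add]
    ring_nf
  rw [hb, hd, div_pow, show (B ^ (k + 2)) ^ 2 = B ^ (2 * (k + 2)) by rw [← pow_mul]; ring_nf]
  have h34 : 3 / 4 ≤ (1 - 1 / B ^ 8) ^ 2 := by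
    have h8 : (8:ℝ) ^ 8 ≤ B ^ 8 := pow_le_pow_left₀ (by norm_num) hB 8
    have : 1 / B ^ 8 ≤ 1 / 8 := by
      rw [div_le_div_iff₀ (by positivity) (by norm_num)]
      nlinarith
    nlinarith
  have h6 : 1 / B ^ 27 ≤ 1 / 2 := by
    rw [div_le_div_iff₀ (by positivity) (by norm_num)]
    nlinarith [pow_le_pow_left₀ (by norm_num : (0:ℝ) ≤ 8) hB 27]
  have hAD : 1 / 2 ≤ (1 - 1 / B ^ 8) ^ 2 / (1 + 1 / B ^ 27) := by
    rw [le_div_iff₀ (by positivity)]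
    nlinarith
  calc 1 / B ^ (2 * (k + 2)) / 2 = (1 / 2) * (1 / B ^ (2 * (k + 2))) := by ring
    _ ≤ ((1 - 1 / B ^ 8) ^ 2 / (1 + 1 / B ^ 27)) * (1 / B ^ (2 * (k + 2))) :=
        mul_le_mul_of_nonneg_right hAD (by positivity)
    _ = (1 - 1 / B ^ 8) ^ 2 / B ^ (2 * (k + 2)) / (1 + 1 / B ^ 27) := by ring

/-- The corner (hub) entry `c(t) = ((-1)^M / B^{2M+2})·(1 - t/B^{8M+7})` is at most `1/B^{2M+2}` in modulus for
`0 ≤ t ≤ B^{8M+7}`. [folklore] -/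
theorem arrowCorner_abs_le {B t : ℝ} (hB : 0 < B) (M : ℕ) (ht0 : 0 ≤ t) (ht : t ≤ B ^ (8 * M + 7)) :
    |(-1) ^ M / B ^ (2 * M + 2) + -(-1) ^ M / B ^ (10 * M + 9) * t| ≤ 1 / B ^ (2 * M + 2) := by
  have hx : (-1 : ℝ) ^ M / B ^ (2 * M + 2) + -(-1) ^ M / B ^ (10 * M + 9) * t
      = (-1) ^ M * ((1 - t / B ^ (8 * M + 7)) / B ^ (2 * M + 2)) := by
    field_simp
    ring
  rw [hx, abs_mul, abs_pow, abs_neg, abs_one, one_pow, one_mul, abs_div, abs_of_pos (by positivity : (0:ℝ) < B ^ (2 * M + 2))]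
  refine div_le_div_of_nonneg_right ?_ (by positivity)
  rw [abs_le]
  constructor
  · have : t / B ^ (8 * M + 7) ≤ 1 := by rw [div_le_one (by positivity)]; exact ht
    linarith
  · have : 0 ≤ t / B ^ (8 * M + 7) := by positivity
    linarith

/-- The corner entry at the three hub readings: `(-1)^M c(B^{8M-1})` (written with `8k+7`, `k+1 = M`),
`(-1)^M c(B^{8M+6})` and `-(-1)^M c(B^{8M+8})` are all `≥ ½ / B^{2M+2}` (`B ≥ 2`). [folklore] -/
theorem arrowCorner_ref {B : ℝ} (hB : 2 ≤ B) (M : ℕ) :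
    (∀ k : ℕ, k + 1 = M → 1 / B ^ (2 * M + 2) / 2 ≤
        (-1) ^ M * ((-1) ^ M / B ^ (2 * M + 2) + -(-1) ^ M / B ^ (10 * M + 9) * B ^ (8 * k + 7))) ∧
      1 / B ^ (2 * M + 2) / 2 ≤
        (-1) ^ M * ((-1) ^ M / B ^ (2 * M + 2) + -(-1) ^ M / B ^ (10 * M + 9) * B ^ (8 * M + 6)) ∧
      1 / B ^ (2 * M + 2) / 2 ≤
        (-1) ^ (M + 1) * ((-1) ^ M / B ^ (2 * M + 2) + -(-1) ^ M / B ^ (10 * M + 9) * B ^ (8 * M + 8)) := by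
  have hB0 : 0 < B := by linarith
  have hsq : ((-1 : ℝ) ^ M) * (-1) ^ M = 1 := by rw [← pow_add, ← two_mul, pow_mul]; norm_num
  have key : ∀ t : ℝ, (-1 : ℝ) ^ M * ((-1) ^ M / B ^ (2 * M + 2) + -(-1) ^ M / B ^ (10 * M + 9) * t)
      = (1 - t / B ^ (8 * M + 7)) / B ^ (2 * M + 2) := by
    intro t
    have h1 : (-1 : ℝ) ^ M * ((-1) ^ M / B ^ (2 * M + 2) + -(-1) ^ M / B ^ (10 * M + 9) * t)
        = ((-1 : ℝ) ^ M * (-1) ^ M) * (1 / B ^ (2 * M + 2) - t / B ^ (10 * M + 9)) := by ring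
    rw [h1, hsq, one_mul]
    field_simp
    ring
  refine ⟨fun k hk => ?_, ?_, ?_⟩
  · rw [key, div_div, div_le_div_iff₀ (by positivity) (by positivity), one_mul]
    have hx : B ^ (8 * k + 7) / B ^ (8 * M + 7) = 1 / B ^ 8 := by
      rw [div_eq_div_iff (by positivity) (by positivity), one_mul, ← pow_add, ← hk]; ring_nf
    rw [hx]
    have : 1 / B ^ 8 ≤ 1 / 2 := by
      rw [div_le_div_iff₀ (by positivity) (by norm_num)]
      nlinarith [pow_le_pow_left₀ (by norm_num : (0:ℝ) ≤ 2) hB 8]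
    nlinarith [pow_pos hB0 (2 * M + 2)]
  · rw [key, div_div, div_le_div_iff₀ (by positivity) (by positivity), one_mul]
    have hx : B ^ (8 * M + 6) / B ^ (8 * M + 7) = 1 / B := by
      rw [div_eq_div_iff (by positivity) (by positivity), one_mul, ← pow_succ]
    rw [hx]
    have : 1 / B ≤ 1 / 2 := by rw [div_le_div_iff₀ hB0 (by norm_num)]; linarith
    nlinarith [pow_pos hB0 (2 * M + 2)]
  · have hx : B ^ (8 * M + 8) / B ^ (8 * M + 7) = B := by
      rw [div_eq_iff (by positivity), ← pow_succ']
    have h3 : (-1 : ℝ) ^ (M + 1) * ((-1) ^ M / B ^ (2 * M + 2) + -(-1) ^ M / B ^ (10 * M + 9) * B ^ (8 * M + 8))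
        = (B - 1) / B ^ (2 * M + 2) := by
      have := key (B ^ (8 * M + 8))
      rw [hx] at this
      rw [pow_succ, mul_comm ((-1 : ℝ) ^ M) (-1), mul_assoc, this]
      ring
    rw [h3, div_div, div_le_div_iff₀ (by positivity) (by positivity), one_mul]
    nlinarith [pow_pos hB0 (2 * M + 2)]


/-! ## §3 Uniform per-term bounds for the leaves (plateau above, decay below the current scale) -/

/-- The leaf term `G_j(t) = b_j(t)² / (1 + t³/B^{24(j+1)})` (local notation, no definition). -/
local notation3 (prettyPrint := false) "G[" B ", " j "](" t ")" =>
  ((1 / (B : ℝ) ^ ((j : ℕ) + 1) - (t : ℝ) / (B : ℝ) ^ (9 * (j : ℕ) + 8)) ^ 2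
    / (1 + (t : ℝ) ^ 3 / (B : ℝ) ^ (24 * ((j : ℕ) + 1))))

/-- The corner entry `c(t)` (local notation, no definition). -/
local notation3 (prettyPrint := false) "cor[" B ", " M "](" t ")" =>
  ((-1 : ℝ) ^ (M : ℕ) / (B : ℝ) ^ (2 * (M : ℕ) + 2) + -(-1 : ℝ) ^ (M : ℕ) / (B : ℝ) ^ (10 * (M : ℕ) + 9) * (t : ℝ))

/-- Powers of the base: `B^a / B^b ≤ 1/B^c` when `a + c ≤ b` (`B ≥ 1`). [folklore] -/
theorem pow_div_pow_le_one_div {B : ℝ} (hB : 1 ≤ B) {a b c : ℕ} (h : a + c ≤ b) : B ^ a / B ^ b ≤ 1 / B ^ c := by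
  have hB0 : 0 < B := by linarith
  rw [div_le_div_iff₀ (by positivity) (by positivity), ← pow_add, one_mul]
  exact pow_le_pow_right₀ hB h

/-- A leaf ABOVE the current scale is on its plateau: `G_j(t) ≤ 1/B^e` for `t ≤ B^{8j+7}`, `e ≤ 2j + 2`. [folklore] -/
theorem arrowLeaf_above_le {B t : ℝ} (hB : 1 ≤ B) (j : ℕ) {e : ℕ} (ht0 : 0 ≤ t) (ht : t ≤ B ^ (8 * j + 7))
    (he : e ≤ 2 * (j + 1)) : G[B, j](t) ≤ 1 / B ^ e :=
  (arrowLeaf_plateau hB j ht0 ht).trans (one_div_pow_le_one_div_pow_of_le hB he)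

/-- A leaf BELOW the current scale has decayed: `G_j(t) ≤ 1/B^e` for `t ≥ B^n`, `8j + 7 ≤ n`, `6j + 8 + e ≤ n`. [folklore] -/
theorem arrowLeaf_below_le {B t : ℝ} (hB : 1 ≤ B) (j : ℕ) {e n : ℕ} (ht : B ^ n ≤ t) (hn : 8 * j + 7 ≤ n)
    (he : 6 * j + 8 + e ≤ n) : G[B, j](t) ≤ 1 / B ^ e := by
  have hB0 : 0 < B := by linarith
  have ht' : B ^ (8 * j + 7) ≤ t := (pow_le_pow_right₀ hB hn).trans ht
  have htpos : 0 < t := lt_of_lt_of_le (by positivity) ht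
  calc G[B, j](t) ≤ B ^ (6 * j + 8) / t := arrowLeaf_decay hB j ht'
    _ ≤ B ^ (6 * j + 8) / B ^ n := div_le_div_of_nonneg_left (by positivity) (by positivity) ht
    _ ≤ 1 / B ^ e := pow_div_pow_le_one_div hB he

/-- A signed leaf term has the modulus of the leaf term. [bookkeeping] -/
theorem abs_arrowLeaf_signed {B t : ℝ} (hB : 0 < B) (ht : 0 ≤ t) (a b : ℕ) (j : ℕ) :
    |-((-1 : ℝ) ^ a * ((-1 : ℝ) ^ b * G[B, j](t)))| = G[B, j](t) := by
  rw [abs_neg, abs_mul, abs_mul, abs_pow, abs_pow, abs_neg, abs_one, one_pow, one_pow, one_mul, one_mul]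
  exact abs_of_nonneg (by positivity)

end Summit.ValiantsHypothesis.ValiantsHypothesis.Theorems.LacunarySymmetroidMatrixDescartes.FiniteSector
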